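import Literature.IUT.HodgeTheaters.KitNFSideULift
import Literature.IUT.HodgeTheaters.KitNFSideEvalNonVacuityWitness
import Literature.IUT.HodgeTheaters.FKitCoreBridgeWitness
import HarnessLib

/-!
# `S5Local.ofDatum` / `IsoKit.ofDatum` FIRE at closed data (KIT-RULE, universe `1`): the ΘNF-side kit read off
# abc-iut-L5-t3's Definition 5.5 typing has an inhabitant of its joint hypotheses

S. Mochizuki, *Inter-universal Teichmüller theory I*, kurims manuscript (May 2020): Def 4.1 p. 95, Ex 4.3 (ii) p. 99,
Ex 4.4 (i)(ii) pp. 105–107, Def 5.2 (i) p. 134, Ex 5.4 (iii) p. 149, Def 5.5 (iii) p. 153, Cor 5.6 (i) p. 153, Def 6.13 (i)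
p. 182, Rmk 6.12.2 (ii) p. 174 ([IUTchI] Def 5.5 (iii) p.153) [claim: Mochizuki2012, status: disputed] (D-0012 claim key;
CONSISTENCY WITNESS for the cell's hypothesis structures — nothing of the series is asserted, no side is taken on
[IUTchIII] Cor. 3.12).

## What is witnessed, and why only now

abc-iut-L5-t5's `BaseThetaDatum.S5Local.ofDatum fc nl` (`KitS5LocalOfDatum.lean`) and `IsoKit.ofDatum`
(`KitIsoKitOfDatum.lean`) instantiate the ΘNF-side §5/§6 kit from: a §4 datum `𝔡 : BaseThetaDatum.{u+1}`, a base kit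
`K : PMBaseKit.{u+1} 𝔡.l`, abc-iut-L5-t3's §5-R4 data `S : S5Local 𝔡`, dictionaries `c : KitCore 𝔡 K`, `fc : FKitCore S c FK`,
`nl : NFLink c`.  The universe is FORCED to be a successor (`ThetaNFHodgeTheater : Type (max 1 u)` fills a `Type U` slot);
every closed kit of the tree lives in universe `0`; and at universe `0` the two closed-data families were disjoint
(abc-iut-w5-d217's `thickDatum` family has `S5Local`/`FKitCore` but no `NFLink`; abc-iut-L5-t3 / abc-iut-L5-t17's `ofKitCore` family
has `NFLink.ofKit` but no `S5Local`/`FKitCore`).  So until this file NO inhabitant of the joint hypotheses of `ofDatum`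
existed at any universe where it elaborates (abc-iut-L5-t5 g4, U1 memo, kernel rejection F1).  Here:

* `BaseThetaDatum.S5Local.ofKitCore` — a §5-R4 stub over abc-iut-L5-t3's converse datum `ofKitCore K … N B E`
  (abc-iut-w5-d217's `thickS5Local` pattern: `ℱ_v`-data := isomorphs of `𝒟_v` with identity base, `ℱ^⊚`/`ℱ^⊛` := the NF
  kit's isomorphs of `𝒟^⊚`, Θ-Hodge theaters := the core groupoid of families of isomorphs), universe-polymorphic,
  under ONE named hypothesis `hval` — «automorphisms of `𝒟^⊚` fix the distinguished valuations `𝕍̲ ⊆ 𝕍(†𝒟^⊚)`» — used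
  for the valuation clause of Ex 5.4 (iii) (`valOfNF`).  HONEST LABEL: `hval` holds for the degenerate NF kits of the
  tree (constant valuation sets) and is NOT a statement of print (there `Aut(C_K)` moves `𝕍(K)`); the stub is a
  consistency device, not print's `ℱ`-data;
* `S5Local.FKitCore.ofKitCore` — the ℱ-level core agreement of that stub with abc-iut-w5-d217's `FKit.ofBase K M`
  (identities), with Cor 5.6 (i) fired: `S5Local.cor56i_ofKitCore`;
* universe `u+1`, still generic: `gluingUnique_ofKitCore` / `gluingTransportLaw_and_gluingUniqueBad_ofKitCore` — abc-iut-L5-t3's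
  «Consequences» of `KitNFSideEval.lean` with their `S`/`fc` binders SUPPLIED;
* **closed data at universe `1`** (`ULiftToy`): the thickened one-bad-place toy kit of abc-iut-L5-t17 LIFTED by
  `PMBaseKit.ulift.{0,1}`, its NF kit `(NFKit.toyBad).ulift`, the tautological mono-analytic binder, the lifted thick
  multiplicative kit with abc-iut-L5-t17's `hne`/`hrig`/`hsat` discharges transferred, `hval` by `rfl`; whence the terms
  **`ULiftToy.thetaNFKit := S5Local.ofDatum …`**, **`ULiftToy.isoKit := IsoKit.ofDatum …`** and the theorems
  `ULiftToy.gluingUnique` (Def 6.13 (i)(c) / Rmk 6.12.2 (ii) at the fired kit), `ULiftToy.gluingTransportLaw_and_gluingUniqueBad`,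
  `ULiftToy.cor56i`, packaged as `exists_ofDatum_inputs` — for every prime `l ≥ 5`, and at `l = 5`.

(The arithmetic-side companion for the eventual END instantiation — `F̄ := ULift.{1} (AlgebraicClosure F)` — is abc-iut-L5-t5's
`isAlgClosure_ulift`, `Literature/FieldTheory/AlgClosed/ULift.lean`; it is not needed for the toy.)  An inhabitant shows the
binder set is jointly satisfiable — nothing more; the toy is degenerate where abc-iut-L5-t4's
`toyKit` is (one place, `Aut(𝒟_v) = {±1}`, affine `Aut(𝒟^{⊚±})`).  Every `theorem` is kernel-checked; typed ≠ proved elsewhere.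
-/

namespace Literature.IUT.HodgeTheaters

open CategoryTheory

universe u

/-! ### Structured Θ-Hodge theaters of `FKit.ofBase` named by families of isomorphs (abc-iut-w5-d217's pattern, any kit) -/

namespace PMBaseKit

variable {l : ℕ} (K' : PMBaseKit.{u} l) (M : K'.MultKit)

/-- The structured Θ-Hodge theater of `FKit.ofBase K' M` named by a family of isomorphs of the models (local data and
`𝔉^⊩`-data both the family, compatibility the identity; abc-iut-w5-d217's `thickHT` over any base kit).
([IUTchI] Def 3.6 p.87) [claim: Mochizuki2012, status: disputed] -/
noncomputable def htOfFamily (X : Core (∀ x : K'.V, K'.LocalObj x)) : (FKit.ofBase K' M).ThetaHT where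
  th := X.of
  th_isModel x := ⟨ObjectProperty.isoMk _ ((X.of x).property.some)⟩
  rlf := X.of
  rlf_isModel := ⟨Pi.isoMk fun x => ObjectProperty.isoMk _ ((X.of x).property.some)⟩
  rlf_fm _ := Iso.refl _

/-- An isomorphism of families induces an isomorphism of the structured Θ-Hodge theaters (abc-iut-w5-d217's
`thickHTIso` over any base kit). ([IUTchI] Cor 5.6 (i) p.153) [claim: Mochizuki2012, status: disputed] -/
noncomputable def htIsoOfFamily {X Y : Core (∀ x : K'.V, K'.LocalObj x)} (φ : X ≅ Y) :
    FKit.ThetaHT.Iso (K'.htOfFamily M X) (K'.htOfFamily M Y) where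
  thIso x := Pi.isoApp φ.hom.iso x
  rlfIso := φ.hom.iso
  compat _ := by
    change φ.hom.iso.hom _ ≫ 𝟙 _ = 𝟙 _ ≫ φ.hom.iso.hom _
    rw [Category.comp_id, Category.id_comp]

/-- `htIsoOfFamily` is a bijection on isomorphisms (abc-iut-w5-d217's `thickHTIso_bijective` over any base kit).
([IUTchI] Cor 5.6 (i) p.153) [claim: Mochizuki2012, status: disputed] -/
theorem htIsoOfFamily_bijective (X Y : Core (∀ x : K'.V, K'.LocalObj x)) :
    Function.Bijective (K'.htIsoOfFamily M : (X ≅ Y) → _) := by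
  constructor
  · intro φ ψ h
    have h' : φ.hom.iso = ψ.hom.iso := congrArg FKit.ThetaHT.Iso.rlfIso h
    exact Iso.ext (CoreHom.ext h')
  · rintro ⟨t, r, hc⟩
    refine ⟨Core.isoMk r, ?_⟩
    have hr : (Core.isoMk r).hom.iso = r := Core.isoMk_hom_iso r
    have ht : ∀ x, Pi.isoApp r x = t x := fun x => by
      apply Iso.ext
      have hx := hc x
      change r.hom x ≫ 𝟙 _ = 𝟙 _ ≫ (t x).hom at hx
      rw [Category.comp_id, Category.id_comp] at hx
      exact hx
    have key : ∀ (a : ∀ x, (K'.htOfFamily M X).th x ≅ (K'.htOfFamily M Y).th x)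
        (b : (K'.htOfFamily M X).rlf ≅ (K'.htOfFamily M Y).rlf) (hb), a = t → b = r →
        (FKit.ThetaHT.Iso.mk a b hb : FKit.ThetaHT.Iso (K'.htOfFamily M X) (K'.htOfFamily M Y)) = ⟨t, r, hc⟩ := by
      rintro a b hb rfl rfl; rfl
    refine key _ _ _ (funext fun x => ?_) hr
    exact (congrArg (fun e => Pi.isoApp e x) hr).trans (ht x)

end PMBaseKit

/-! ### A §5-R4 stub and its ℱ-level core agreement over the converse datum `ofKitCore` -/

namespace BaseThetaDatum

open PMBaseKit

/-- The valuation bookkeeping behind the stub's `valOfNF` (Ex 5.4 (iii)): under `hval`, transporting the distinguished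
valuation `v` along chosen isomorphisms `𝒟^⊚ ⥲ †𝒟^⊚`, `𝒟^⊚ ⥲ ‡𝒟^⊚` is compatible with any `†𝒟^⊚ ⥲ ‡𝒟^⊚`.
([IUTchI] Ex 5.4 (iii) p.149) [claim: Mochizuki2012, status: disputed] -/
theorem _root_.Literature.IUT.HodgeTheaters.PMBaseKit.NFKit.valIso_valOfV_wd {l : ℕ} {K : PMBaseKit.{u} l}
    (N : K.NFKit) (hv : ∀ (b : N.gnfModel ≅ N.gnfModel) (x : K.V), N.valIso b (N.valOfV x) = N.valOfV x) {Y Y' : N.GlobNF}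
    (cY : N.gnfModel ≅ Y) (cY' : N.gnfModel ≅ Y') (b : Y ≅ Y') (x : K.V) :
    N.valIso cY' (N.valOfV x) = N.valIso b (N.valIso cY (N.valOfV x)) := by
  have h := hv (cY ≪≫ b ≪≫ cY'.symm) x
  have e3 : (cY ≪≫ b ≪≫ cY'.symm) ≪≫ cY' = cY ≪≫ b := by
    simp only [Iso.trans_assoc, Iso.symm_self_id, Iso.trans_refl]
  calc N.valIso cY' (N.valOfV x) = N.valIso cY' (N.valIso (cY ≪≫ b ≪≫ cY'.symm) (N.valOfV x)) := by rw [h]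
    _ = N.valIso ((cY ≪≫ b ≪≫ cY'.symm) ≪≫ cY') (N.valOfV x) := by rw [N.valIso_trans _ cY']; rfl
    _ = N.valIso (cY ≪≫ b) (N.valOfV x) := by rw [e3]
    _ = N.valIso b (N.valIso cY (N.valOfV x)) := by rw [N.valIso_trans]; rfl

variable {l : ℕ} (K : PMBaseKit.{u} l) [Fact l.Prime] (hl5 : 5 ≤ l) (hba : ∀ x ∈ K.bad, x ∉ K.arc)
  (hb : K.bad.Nonempty) (N : K.NFKit) (B : K.MonoBinder) (E : K.EvalBinder)
  (hval : ∀ (b : N.gnfModel ≅ N.gnfModel) (x : K.V), N.valIso b (N.valOfV x) = N.valOfV x)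

/-- **A §5-R4 stub over the converse datum** (KIT-RULE inhabitant of abc-iut-L5-t3's `S5Local` over `ofKitCore K … N B E`,
abc-iut-w5-d217's `thickS5Local` pattern): `ℱ_v`-data := the isomorphs of `𝒟_v` themselves with identity base (Def 5.2
(i), Rmk 5.2.1 (i)); `ℱ^⊚`-, `ℱ^⊛`-data := the NF kit's isomorphs of `𝒟^⊚` with identity base (Ex 5.1 (iii), Def 5.5
(i)(b)); `ℱ^⊚ ⇢ ℱ^⊛` and restriction data trivial; Θ-Hodge theaters := the core groupoid of families of isomorphs, the
tautologically associated strip the family itself (Def 3.6, p. 147); the valuation of a `φ^NF`-type morphism into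
`†𝒟^⊚` (Ex 5.4 (iii)) := the distinguished valuation `v` transported along any `𝒟^⊚ ⥲ †𝒟^⊚` — well defined by the
hypothesis `hval` (HONEST LABEL: true for the tree's degenerate NF kits, not a statement of print).
([IUTchI] Def 5.2 (i) p.134) [claim: Mochizuki2012, status: disputed] -/
noncomputable def S5Local.ofKitCore : (ofKitCore K hl5 hba hb N B E).S5Local where
  FAmb x := K.LocalObj x
  F x := K.localModel x
  nonempty_isoF _ X Y := ⟨(ObjectProperty.fullyFaithfulι _).preimageIso (X.property.some ≪≫ Y.property.some.symm)⟩
  base _ := 𝟭 _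
  FAmbG := N.GlobNF
  FG := N.gnfModel
  nonempty_isoFG := N.gnf_iso
  baseG Y := Y
  baseGIso b := b
  baseGIso_refl _ := rfl
  baseGIso_trans _ _ := rfl
  FAmbGlob := N.GlobNF
  FGlob := N.gnfModel
  nonempty_isoFGlob := N.gnf_iso
  DashArrow _ _ := PUnit
  dashModel := PUnit.unit
  restrictAt _ _ x := K.localModel x
  ThetaHT := Core (∀ x : K.V, K.LocalObj x)
  HT := ⟨fun x => K.localModel x⟩
  nonempty_isoHT X Y :=
    ⟨Core.isoMk (Pi.isoMk fun x =>
      (ObjectProperty.fullyFaithfulι _).preimageIso ((X.of x).property.some ≪≫ (Y.of x).property.some.symm))⟩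
  assocStrip X x := X.of x
  assocStripIso φ x := Pi.isoApp φ.hom.iso x
  valOfNF {x} {_} {Y} _ := N.valIso (N.gnf_iso N.gnfModel Y).some (N.valOfV x)
  valOfNF_postNF := fun {x} {_} {_} {_} _ b => N.valIso_valOfV_wd hval _ _ b x
  valOfNF_preNF _ _ := rfl
  valOfNF_phiNF x := hval _ x
  RestrictionDatum _ _ := PUnit
  restrictionOf _ _ _ := PUnit.unit

variable (M : K.MultKit)

/-- **`FKitCore` over the converse datum**: the stub `S5Local.ofKitCore` core-agrees, over abc-iut-L5-t3's identity
dictionary `KitCore.ofKit` (`e = id`), with abc-iut-w5-d217's ℱ-kit `FKit.ofBase K M` — comparison functors and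
`baseComm` identities, Θ-Hodge theaters compared by `htOfFamily`/`htIsoOfFamily` (bijective on isomorphisms), associated
strips literally equal. ([IUTchI] Def 5.2 (i) p.134) [claim: Mochizuki2012, status: disputed] -/
noncomputable def S5Local.FKitCore.ofKitCore :
    (S5Local.ofKitCore K hl5 hba hb N B E hval).FKitCore (KitCore.ofKit K hl5 hba hb N B E) (FKit.ofBase K M) where
  famb _ := 𝟭 _
  fambFF _ := Functor.FullyFaithful.id _
  fambModel _ := Iso.refl _
  baseComm _ := Iso.refl _
  ht := K.htOfFamily M
  htIso φ := K.htIsoOfFamily M φ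
  htIso_bijective := K.htIsoOfFamily_bijective M
  assocIso _ _ := Iso.refl _
  assoc_natural φ x := by
    change (Pi.isoApp φ.hom.iso x).hom ≫ 𝟙 _ = 𝟙 _ ≫ (Pi.isoApp φ.hom.iso x).hom
    rw [Category.comp_id, Category.id_comp]

/-- **[IUTchI] Cor 5.6 (i) FIRES for the stub `S5Local.ofKitCore`** (abc-iut-w5-d217's junction `cor56i_of_cor56iKit` fed
with `FKitCore.ofKitCore`, `cor56iKit_ofBase`, `isomFtoDBijective_ofBase`; `e = id`).
([IUTchI] Cor 5.6 (i) p.153) [claim: Mochizuki2012, status: disputed] -/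
theorem S5Local.cor56i_ofKitCore (M : K.MultKit) :
    BaseThetaDatum.S5Local.Cor56i (S5Local.ofKitCore K hl5 hba hb N B E hval) :=
  (S5Local.FKitCore.ofKitCore K hl5 hba hb N B E hval M).cor56i_of_cor56iKit Function.surjective_id
    (cor56iKit_ofBase K M) (isomFtoDBijective_ofBase K M)

/-! ### Universe `u+1`: abc-iut-L5-t3's «Consequences» with their `S`/`fc` binders supplied -/

section Consequences

/-- **Def 6.13 (i)(c) / Rmk 6.12.2 (ii) `GluingUnique` for the ΘNF-side kit FIRED over the converse datum** — abc-iut-L5-t3's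
`gluingUnique_ofKit` with `S := S5Local.ofKitCore …`, `fc := FKitCore.ofKitCore …` supplied; conditional only on the
named kit inputs `hne`/`hrig`/`hsat` and `hval`, and `Odd l`. ([IUTchI] Def 6.13 (i) p.182) [claim: Mochizuki2012, status: disputed] -/
theorem gluingUnique_ofKitCore
    (K₁ : PMBaseKit.{u+1} l) (hba₁ : ∀ x ∈ K₁.bad, x ∉ K₁.arc) (hb₁ : K₁.bad.Nonempty) (N₁ : K₁.NFKit)
    (B₁ : K₁.MonoBinder) (M₁ : K₁.MultKit) (Z₁ : ∀ x : K₁.V, x ∈ K₁.bad → Set (K₁.model x ⟶ K₁.model x))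
    (hne₁ : ∀ x (hx : x ∈ K₁.bad) j, (M₁.polyOfLabel hl5 Z₁ x hx j).Nonempty)
    (hrig₁ : ∀ x (hx : x ∈ K₁.bad) {j j' : FlAbs l} {g g' : K₁.model x ⟶ K₁.model x}
      (θ β : K₁.model x ≅ K₁.model x), g ∈ M₁.polyOfLabel hl5 Z₁ x hx j → g' ∈ M₁.polyOfLabel hl5 Z₁ x hx j' →
        g' = θ.hom ≫ g ≫ β.hom → j = j')
    (hval₁ : ∀ (b : N₁.gnfModel ≅ N₁.gnfModel) (x : K₁.V), N₁.valIso b (N₁.valOfV x) = N₁.valOfV x)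
    (hsat₁ : ∀ x (hx : x ∈ K₁.bad) (j : Fin (lStar l)) (θ β : K₁.model x ≅ K₁.model x) {g : K₁.model x ⟶ K₁.model x},
      g ∈ M₁.thetaPolyBad j x hx → θ.hom ≫ g ≫ β.hom ∈ M₁.thetaPolyBad j x hx) (hl : Odd l) :
    (S5Local.ofDatum
        (S5Local.FKitCore.ofKitCore K₁ hl5 hba₁ hb₁ N₁ B₁ (M₁.evalBinder hl5 Z₁ hne₁ hrig₁) hval₁ M₁)
        (NFLink.ofKit K₁ hl5 hba₁ hb₁ N₁ B₁ (M₁.evalBinder hl5 Z₁ hne₁ hrig₁))).GluingUnique hl :=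
  gluingUnique_ofKit hl5 K₁ hba₁ hb₁ N₁ B₁ M₁ Z₁ hne₁ hrig₁ _ hsat₁ hl

/-- **Laws (δ) `GluingTransportLaw` ∧ `GluingUniqueBad` for the ΘNF-side kit FIRED over the converse datum** — abc-iut-L5-t3's
`gluingTransportLaw_and_gluingUniqueBad_ofKit` with `S`/`fc` supplied. ([IUTchI] Def 6.13 (i) p.182) [claim: Mochizuki2012, status: disputed] -/
theorem gluingTransportLaw_and_gluingUniqueBad_ofKitCore
    (K₁ : PMBaseKit.{u+1} l) (hba₁ : ∀ x ∈ K₁.bad, x ∉ K₁.arc) (hb₁ : K₁.bad.Nonempty) (N₁ : K₁.NFKit)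
    (B₁ : K₁.MonoBinder) (M₁ : K₁.MultKit) (Z₁ : ∀ x : K₁.V, x ∈ K₁.bad → Set (K₁.model x ⟶ K₁.model x))
    (hne₁ : ∀ x (hx : x ∈ K₁.bad) j, (M₁.polyOfLabel hl5 Z₁ x hx j).Nonempty)
    (hrig₁ : ∀ x (hx : x ∈ K₁.bad) {j j' : FlAbs l} {g g' : K₁.model x ⟶ K₁.model x}
      (θ β : K₁.model x ≅ K₁.model x), g ∈ M₁.polyOfLabel hl5 Z₁ x hx j → g' ∈ M₁.polyOfLabel hl5 Z₁ x hx j' →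
        g' = θ.hom ≫ g ≫ β.hom → j = j')
    (hval₁ : ∀ (b : N₁.gnfModel ≅ N₁.gnfModel) (x : K₁.V), N₁.valIso b (N₁.valOfV x) = N₁.valOfV x)
    (hsat₁ : ∀ x (hx : x ∈ K₁.bad) (j : Fin (lStar l)) (θ β : K₁.model x ≅ K₁.model x) {g : K₁.model x ⟶ K₁.model x},
      g ∈ M₁.thetaPolyBad j x hx → θ.hom ≫ g ≫ β.hom ∈ M₁.thetaPolyBad j x hx) (hl : Odd l) :
    (S5Local.ofDatum
        (S5Local.FKitCore.ofKitCore K₁ hl5 hba₁ hb₁ N₁ B₁ (M₁.evalBinder hl5 Z₁ hne₁ hrig₁) hval₁ M₁)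
        (NFLink.ofKit K₁ hl5 hba₁ hb₁ N₁ B₁ (M₁.evalBinder hl5 Z₁ hne₁ hrig₁))).GluingTransportLaw hl ∧
    (S5Local.ofDatum
        (S5Local.FKitCore.ofKitCore K₁ hl5 hba₁ hb₁ N₁ B₁ (M₁.evalBinder hl5 Z₁ hne₁ hrig₁) hval₁ M₁)
        (NFLink.ofKit K₁ hl5 hba₁ hb₁ N₁ B₁ (M₁.evalBinder hl5 Z₁ hne₁ hrig₁))).GluingUniqueBad hl :=
  gluingTransportLaw_and_gluingUniqueBad_ofKit hl5 K₁ hba₁ hb₁ N₁ B₁ M₁ Z₁ hne₁ hrig₁ _ hsat₁ hl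

end Consequences

end BaseThetaDatum

/-! ### Closed data at universe `1`: the lifted thickened toy kit -/

namespace ULiftToy

open PMBaseKit BaseThetaDatum

variable (l : ℕ) [Fact l.Prime] (hl5 : 5 ≤ l)

/-- The universe-`0` kit to be lifted: abc-iut-L5-t17's one-bad-place toy kit, thickened (abc-iut-w5-d217).
([IUTchI] Def 6.1 p.156) [claim: Mochizuki2012, status: disputed] -/
noncomputable abbrev kit₀ : PMBaseKit.{0} l := (toyKitBad l hl5).thicken

/-- **The universe-`1` base kit**: `kit₀` lifted by `PMBaseKit.ulift.{0,1}`. ([IUTchI] Def 6.1 p.156) [claim: Mochizuki2012, status: disputed] -/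
noncomputable abbrev kit : PMBaseKit.{1} l := PMBaseKit.ulift.{0, 1} (kit₀ l hl5)

/-- `𝕍^bad ∩ 𝕍^arc = ∅` for the lifted kit (Def 3.1 (b)(e)). ([IUTchI] Def 3.1 (e) p.62) [claim: Mochizuki2012, status: disputed] -/
theorem bad_not_arc : ∀ x ∈ (kit l hl5).bad, x ∉ (kit l hl5).arc := toyKitBad_bad_not_arc hl5

/-- `𝕍^bad ≠ ∅` for the lifted kit (Def 3.1 (e)). ([IUTchI] Def 3.1 (e) p.62) [claim: Mochizuki2012, status: disputed] -/
theorem bad_nonempty : (kit l hl5).bad.Nonempty := toyKitBad_bad_nonempty hl5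

/-- The NF kit: abc-iut-L5-t17's `NFKit.toyBad`, lifted. ([IUTchI] Def 4.1 (v) p.97) [claim: Mochizuki2012, status: disputed] -/
noncomputable abbrev nfKit : (kit l hl5).NFKit := NFKit.ulift.{0, 1} (NFKit.toyBad l hl5)

/-- The multiplicative kit: abc-iut-w5-d217's thick multiplicative kit, lifted. ([IUTchI] Prop 6.7 p.167) [claim: Mochizuki2012, status: disputed] -/
noncomputable abbrev multKit : (kit l hl5).MultKit :=
  MultKit.ulift.{0, 1} ((toyKitBad l hl5).thickMultKit hl5 (toyKitBad_disjoint hl5) (toyKitBad_bad_nonempty hl5))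

/-- The zero-labelled class: abc-iut-L5-t17's `thickZeroClass`, lifted. ([IUTchI] Ex 4.4 (i) p.105) [claim: Mochizuki2012, status: disputed] -/
abbrev zero : ∀ x : (kit l hl5).V, x ∈ (kit l hl5).bad → Set ((kit l hl5).model x ⟶ (kit l hl5).model x) :=
  MultKit.zeroUp.{0, 1} (toyKitBad l hl5).thickZeroClass

/-- `hne` at the lifted data (abc-iut-L5-t17's discharge transferred). ([IUTchI] Ex 4.4 (i) p.105) [claim: Mochizuki2012, status: disputed] -/
theorem hne : ∀ x (hx : x ∈ (kit l hl5).bad) j, ((multKit l hl5).polyOfLabel hl5 (zero l hl5) x hx j).Nonempty :=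
  MultKit.polyOfLabel_ulift_nonempty _ hl5 _
    ((toyKitBad l hl5).thick_polyOfLabel_nonempty hl5 (toyKitBad_disjoint hl5) (toyKitBad_bad_nonempty hl5))

/-- `hrig` at the lifted data (abc-iut-L5-t17's discharge transferred). ([IUTchI] Ex 4.4 (iv) p.107) [claim: Mochizuki2012, status: disputed] -/
theorem hrig : ∀ x (hx : x ∈ (kit l hl5).bad) {j j' : FlAbs l} {g g' : (kit l hl5).model x ⟶ (kit l hl5).model x}
    (θ β : (kit l hl5).model x ≅ (kit l hl5).model x),
    g ∈ (multKit l hl5).polyOfLabel hl5 (zero l hl5) x hx j → g' ∈ (multKit l hl5).polyOfLabel hl5 (zero l hl5) x hx j' →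
      g' = θ.hom ≫ g ≫ β.hom → j = j' :=
  fun x hx _ _ _ _ θ β hg hg' h => MultKit.polyOfLabel_ulift_rigid_of _ hl5 _
    ((toyKitBad l hl5).thick_polyOfLabel_rigid hl5 (toyKitBad_disjoint hl5) (toyKitBad_bad_nonempty hl5)) x hx θ β hg hg' h

/-- `hsat` at the lifted data (abc-iut-L5-t17's discharge transferred). ([IUTchI] Ex 4.4 (ii) p.107) [claim: Mochizuki2012, status: disputed] -/
theorem hsat : ∀ x (hx : x ∈ (kit l hl5).bad) (j : Fin (lStar l)) (θ β : (kit l hl5).model x ≅ (kit l hl5).model x)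
    {g : (kit l hl5).model x ⟶ (kit l hl5).model x},
    g ∈ (multKit l hl5).thetaPolyBad j x hx → θ.hom ≫ g ≫ β.hom ∈ (multKit l hl5).thetaPolyBad j x hx :=
  fun x hx j θ β _ hg => MultKit.thetaPolyBad_ulift_saturated_of _
    ((toyKitBad l hl5).thickMultKit_thetaPolyBad_saturated hl5 (toyKitBad_disjoint hl5) (toyKitBad_bad_nonempty hl5))
    x hx j θ β hg

/-- `hval` at the lifted NF kit: the toy's valuation sets are `Unit`. ([IUTchI] Ex 5.4 (iii) p.149) [claim: Mochizuki2012, status: disputed] -/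
theorem hval : ∀ (b : (nfKit l hl5).gnfModel ≅ (nfKit l hl5).gnfModel) (x : (kit l hl5).V),
    (nfKit l hl5).valIso b ((nfKit l hl5).valOfV x) = (nfKit l hl5).valOfV x :=
  fun _ _ => rfl

/-- The evaluation-section binder GENERATED by the lifted multiplicative kit (abc-iut-L5-t3's `MultKit.evalBinder`, with
`hne`/`hrig` discharged). ([IUTchI] Ex 4.4 (ii) p.107) [claim: Mochizuki2012, status: disputed] -/
noncomputable abbrev evalBinder : (kit l hl5).EvalBinder :=
  (multKit l hl5).evalBinder hl5 (zero l hl5) (hne l hl5) (hrig l hl5)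

/-- **The §4 datum at universe `1`**: abc-iut-L5-t3's converse datum over the lifted closed data.
([IUTchI] Def 4.1 p.95) [claim: Mochizuki2012, status: disputed] -/
noncomputable abbrev datum : BaseThetaDatum.{1} :=
  ofKitCore (kit l hl5) hl5 (bad_not_arc l hl5) (bad_nonempty l hl5) (nfKit l hl5) (MonoBinder.tautological _)
    (evalBinder l hl5)

/-- The ℱ-level core agreement at the closed data. ([IUTchI] Def 5.2 (i) p.134) [claim: Mochizuki2012, status: disputed] -/
noncomputable abbrev fKitCore :=
  S5Local.FKitCore.ofKitCore (kit l hl5) hl5 (bad_not_arc l hl5) (bad_nonempty l hl5) (nfKit l hl5)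
    (MonoBinder.tautological _) (evalBinder l hl5) (hval l hl5) (multKit l hl5)

/-- The `φ^NF` dictionary at the closed data (abc-iut-L5-t3's identity dictionary). ([IUTchI] Ex 4.3 (ii) p.99) [claim: Mochizuki2012, status: disputed] -/
noncomputable abbrev nfLink :=
  NFLink.ofKit (kit l hl5) hl5 (bad_not_arc l hl5) (bad_nonempty l hl5) (nfKit l hl5) (MonoBinder.tautological _)
    (evalBinder l hl5)

/-- **`S5Local.ofDatum` FIRED**: abc-iut-L5-t5's ΘNF-side kit instantiated at closed data (universe `1`) — its type of
ΘNF-Hodge theaters IS abc-iut-L5-t3's Def 5.5 (iii) structure over the datum. ([IUTchI] Def 5.5 (iii) p.153) [claim: Mochizuki2012, status: disputed] -/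
noncomputable def thetaNFKit : (kit l hl5).S5Local (multKit l hl5) (FKit.ofBase (kit l hl5) (multKit l hl5)) :=
  S5Local.ofDatum (fKitCore l hl5) (nfLink l hl5)

/-- **`IsoKit.ofDatum` FIRED** at the same closed data. ([IUTchI] Def 5.5 (iii) p.153) [claim: Mochizuki2012, status: disputed] -/
noncomputable def isoKit : (thetaNFKit l hl5).IsoKit :=
  S5Local.IsoKit.ofDatum (fKitCore l hl5) (nfLink l hl5)

/-- The fired kit's type of ΘNF-Hodge theaters is abc-iut-L5-t3's `ThetaNFHodgeTheater` over the closed datum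
(definitional). ([IUTchI] Def 5.5 (iii) p.153) [claim: Mochizuki2012, status: disputed] -/
theorem thetaNFKit_thetaNFHT :
    (thetaNFKit l hl5).ThetaNFHT =
      (S5Local.ofKitCore (kit l hl5) hl5 (bad_not_arc l hl5) (bad_nonempty l hl5) (nfKit l hl5)
        (MonoBinder.tautological _) (evalBinder l hl5) (hval l hl5)).ThetaNFHodgeTheater := rfl

/-- **Def 6.13 (i)(c) / Rmk 6.12.2 (ii) `GluingUnique` HOLDS for the fired kit** (abc-iut-L5-t3's consequence, every
antecedent discharged at the closed data). ([IUTchI] Def 6.13 (i) p.182) [claim: Mochizuki2012, status: disputed] -/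
theorem gluingUnique : (thetaNFKit l hl5).GluingUnique (odd_of_five_le hl5) :=
  gluingUnique_ofKitCore hl5 (kit l hl5) (bad_not_arc l hl5) (bad_nonempty l hl5) (nfKit l hl5)
    (MonoBinder.tautological _) (multKit l hl5) (zero l hl5) (hne l hl5) (hrig l hl5) (hval l hl5) (hsat l hl5) _

/-- **Laws (δ) `GluingTransportLaw` ∧ `GluingUniqueBad` HOLD for the fired kit.** ([IUTchI] Def 6.13 (i) p.182) [claim: Mochizuki2012, status: disputed] -/
theorem gluingTransportLaw_and_gluingUniqueBad :
    (thetaNFKit l hl5).GluingTransportLaw (odd_of_five_le hl5) ∧ (thetaNFKit l hl5).GluingUniqueBad (odd_of_five_le hl5) :=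
  gluingTransportLaw_and_gluingUniqueBad_ofKitCore hl5 (kit l hl5) (bad_not_arc l hl5) (bad_nonempty l hl5) (nfKit l hl5)
    (MonoBinder.tautological _) (multKit l hl5) (zero l hl5) (hne l hl5) (hrig l hl5) (hval l hl5) (hsat l hl5) _

/-- **Cor 5.6 (i) HOLDS for the §5-R4 stub at the closed data.** ([IUTchI] Cor 5.6 (i) p.153) [claim: Mochizuki2012, status: disputed] -/
theorem cor56i :
    BaseThetaDatum.S5Local.Cor56i
      (S5Local.ofKitCore (kit l hl5) hl5 (bad_not_arc l hl5) (bad_nonempty l hl5) (nfKit l hl5)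
        (MonoBinder.tautological _) (evalBinder l hl5) (hval l hl5)) :=
  S5Local.cor56i_ofKitCore (kit l hl5) hl5 (bad_not_arc l hl5) (bad_nonempty l hl5) (nfKit l hl5)
    (MonoBinder.tautological _) (evalBinder l hl5) (hval l hl5) (multKit l hl5)

end ULiftToy

/-! ### Packaged existence -/

/-- **KIT-RULE for `S5Local.ofDatum` / `IsoKit.ofDatum`**: for every prime `l ≥ 5` there exist, in universe `1`, a §4 datum
`𝔡` with `𝔡.l = l`, a base kit `K` with `𝕍^bad ≠ ∅`, §5-R4 data `S`, a `𝒟`-level core agreement `c` with `c.e` bijective, a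
multiplicative kit, an ℱ-kit, an ℱ-level core agreement `fc` and a `φ^NF` dictionary `nl` — ALL the inputs of
abc-iut-L5-t5's `S5Local.ofDatum` at once — such that the instantiated kit satisfies Def 6.13 (i)(c)'s `GluingUnique`.
So the theorems of `KitS5LocalOfDatum*.lean` / `KitIsoKitOfDatum.lean` and abc-iut-L5-t3's «Consequences» are not
vacuous. ([IUTchI] Def 5.5 (iii) p.153) [claim: Mochizuki2012, status: disputed] -/
theorem exists_ofDatum_inputs (l : ℕ) [Fact l.Prime] (hl5 : 5 ≤ l) :
    ∃ (𝔡 : BaseThetaDatum.{1}) (K : PMBaseKit.{1} 𝔡.l) (S : BaseThetaDatum.S5Local 𝔡) (c : 𝔡.KitCore K)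
      (M : K.MultKit) (FK : K.FKit M) (fc : S.FKitCore c FK) (nl : c.NFLink) (hl : Odd 𝔡.l),
      𝔡.l = l ∧ K.bad.Nonempty ∧ Function.Bijective c.e ∧
        (BaseThetaDatum.S5Local.ofDatum fc nl).GluingUnique hl :=
  ⟨ULiftToy.datum l hl5, ULiftToy.kit l hl5, _, _, ULiftToy.multKit l hl5, _, ULiftToy.fKitCore l hl5,
    ULiftToy.nfLink l hl5, PMBaseKit.odd_of_five_le hl5, rfl, ULiftToy.bad_nonempty l hl5, Function.bijective_id,
    ULiftToy.gluingUnique l hl5⟩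

/-- The KIT-RULE witness at `l = 5`. ([IUTchI] Def 5.5 (iii) p.153) [claim: Mochizuki2012, status: disputed] -/
theorem exists_ofDatum_inputs_five :
    ∃ (𝔡 : BaseThetaDatum.{1}) (K : PMBaseKit.{1} 𝔡.l) (S : BaseThetaDatum.S5Local 𝔡) (c : 𝔡.KitCore K)
      (M : K.MultKit) (FK : K.FKit M) (fc : S.FKitCore c FK) (nl : c.NFLink) (hl : Odd 𝔡.l),
      𝔡.l = 5 ∧ K.bad.Nonempty ∧ Function.Bijective c.e ∧
        (BaseThetaDatum.S5Local.ofDatum fc nl).GluingUnique hl :=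
  haveI : Fact (Nat.Prime 5) := ⟨Nat.prime_five⟩
  exists_ofDatum_inputs 5 le_rfl

end Literature.IUT.HodgeTheaters
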